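import Literature.MathematicalPhysics.QuantumFieldTheory.Balaban1983to89.B11Eq27Current
import Literature.MathematicalPhysics.QuantumFieldTheory.Balaban1983to89.B11Eq31V4Bound

/-!
# `Balaban1983to89.B11Eq26ActionExpansion` — T. Bałaban, *The variational problem and background fields in renormalization group method for lattice gauge theories*, Commun. Math. Phys. **102** (1985) 277–309 [Balaban1985Variational]: (26) p. 282 with (29)–(30) — the remainder `V₀(A)` of the expansion of the action `A(U₁U₀)`, «the expansion of V₀(A) begins with a third order polynomial», and its decomposition `V₀ = V⁽³⁾ + V₄`, assembled on the finite lattice of [5] (3.1)–(3.12)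

statement-level skeleton of published theorems with citation tags; proofs where landed; nothing here is a claim about the Yang–Mills mass gap

PDF held: `paper:balaban1985-cmp102-variational-background` (journal page = PDF page + 276).  Render
`run/shared/lean/pub/pub-balaban/b2b-balaban-ref1/pages/1985-cmp102-variational-background/…-p006-x2.png` (p. 282)
READ AS AN IMAGE by this seat (lit-balaban reader/typer r08, gen 5, 2026-08-21).

CITATION HEADER (lean-in-tree rule 2026-08-18).  WHAT IS REPRODUCED: the last member of SKELETON row `B11.Eq24`
(displays (24)–(26) of `HOME/lit-balaban-r08/ROWS-B11.md`) that was still «absent as printed»: (26) itself — the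
sum over the plaquettes, the identification of its terms with `⟨A, J⟩` and `½⟨A, ΔA⟩` of [5] (3.10)–(3.11), the
DEFINITION of `V₀(A)` and the sentence «the expansion of V₀(A) begins with a third order polynomial» — together
with the bookkeeping displays (29)–(30) of row `B11.Eq29`.  Siblings (imported, nothing re-declared):
`B11Eq24TraceExpansion` ((24)–(25) per plaquette), `B11Eq27Current` ((27)–(28): the printed `Im tr` form of the
linear term equals `⟨A, J⟩`), `B11Eq34BCH` ((34): `Z1`, `prod2`, `prod3`), `B11Eq31V4Bound` ((31), (35): the grading
`grade4` of `Π_b exp iηA′(b)` and the fourth-order remainder bound).  THE LATTICE ASSEMBLY IS [5]'s: (26) is the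
display (3.12) of [5] = [Balaban1985BackgroundPropagators] p. 392 with the remainder NAMED, and (3.12) is
`B9Eq39Adjoint.eq312` (cell `pub-balaban`, lineage pv27) — `A^η(U′U₀) = A^η(U₀) + ⟨A,J⟩ + ½⟨A,ΔA⟩ + η^{d−4}Σ_p ρ_p`
with the third-order per-plaquette remainder `ρ_p = B9Eq39Adjoint.rem3` — REUSED BY NAME; this file adds the
B11 names and the B11 sentences on top of it.

THE PRINT (p. 282 [PDF 6], verbatim from the render).  «This expansion gives
  A(U₁U₀) = Σ_{p⊂Ω₀} η^{d−4}[1 − Re tr(U₁U₀)(∂p)] = A(U₀) + Σ_{p⊂Ω₀} η^{d−2} Im tr(DA)(p)U₀(∂p) + ½⟨A, ΔA⟩ + V₀(A), (26)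
where the expansion of V₀(A) begins with a third order polynomial. From hermiticity of DA we have
  Σ_{p⊂Ω₀} η^{d−2} Im tr(DA)(p)U₀(∂p) = Σ_{p⊂Ω₀} η^{d−2} tr(DA)(p) Im U₀(∂p) = ⟨A, J⟩, (27)
[…] The action A(U₁U₀) is an analytic, and even an entire function of A for A ∈ 𝔤ᶜ, or for A in the space of all
complex N × N matrices, so V₀(A) is such a function also. We need a bound for V₀(A). To get such a bound we have to
decompose further
  V₀(A) = V⁽³⁾(A) + V₄(A), (29)
or
  V₀(A) = Σ_{p⊂Ω₀} η^d V₀(A, ∂p),  V₀(A, ∂p) = V⁽³⁾(A, ∂p) + V₄(A, ∂p), (30)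
where V⁽³⁾(A) is a third order polynomial and the expansion of V₄(A) begins with a fourth order polynomial. We
consider these functions for A belonging to the complexified Lie algebra. A bound for V₄ can be easily obtained. We
have |V₄(A, ∂p)| ≦ (1/4!)(|A|(∂p))⁴e^{η|A|(∂p)}. (31)»; p. 283 [PDF 7] (35): «1 − Re tr ∂₀U₁((p)_z)U₀(∂p) = 1 − Re tr U₀(∂p)
+ η⁴Σ_{i=1}^{3} V^{(i)}(A, ∂p) + η⁴V₄(A, ∂p)».

DICTIONARY (the carrier of `B9Eq39Adjoint` §6, NOTHING re-declared).  `𝔸` = a complete normed `ℂ`-algebra (the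
`N × N` matrices); sites `S`, directions `ι` (finite, ordered), shifts `T μ : S ≃ S`, background `U₀ ↦ U : ι → S → 𝔸ˣ`
(arbitrary units, kept EXACT); `A ↦ A : ι → S → 𝔸` a bond field of the COMPLEXIFIED Lie algebra (no hermiticity
unless stated — «We consider these functions for A belonging to the complexified Lie algebra»); `U₁ = exp iηA`,
`U₁U₀ ↦ B9Eq39Adjoint.prodCfg U η A`; `A(·) = A^η(·)` of (5) ↦ `B9Eq39Adjoint.action T η d τ` ((3.1) of [5] in the
complexified reading `1 − Re tr W ↦ τ1 − τ(½(W + W⁻¹))` of [5] p. 391, `B9Eq37Insertion.wil`/`reC`); «tr» ↦ a tracial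
`ℂ`-linear `τ` (`τ(ab) = τ(ba)`); `⟨A, J⟩ ↦ bondPair η d τ A (J T U η)` ((27)/(3.11)); `⟨A, ΔA⟩ ↦ hessPair T U η d τ A`
((3.10)); `Σ_{p⊂Ω₀}` ↦ the sum over the positively oriented plaquettes `posPlaq S ι`; the four exponents of (34),
`Y(b) = iηA′(b)`, `b ⊂ ∂(p)_z` in contour order ↦ `Y T U η A μ ν x : Fin 4 → 𝔸` (= `B9Eq37Insertion.letters η` of
`B9Eq39Adjoint.lettersA`); `|A|(∂p)` ↦ `size (lettersA T U A μ ν x) = Σ_b ‖A′(b)‖` (equal to `Σ_b |A(b)|` when the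
`R(U₀(b))` are isometries; in general only this transported size is used); `η^{d−4}` ↦ `(η : ℂ) ^ (d − 4)` with the
natural-number exponent of `B9Eq39Adjoint.action` (faithful for `d ≧ 4`, the case of the paper's series [11]–[16];
hypotheses `4 ≤ d`, `η ≠ 0` where [5] (3.12) is invoked).

WHAT IS CERTIFIED (kernel, sorry-free; axioms `propext`/`Classical.choice`/`Quot.sound`).
* §1 four letters: `holonomy [Y₁, Y₂, Y₃, Y₄] = e^{Y₁}e^{Y₂}e^{Y₃}e^{Y₄}`, `Σ = Z1`, `quad = grade4 2` (the second-order
  Taylor datum of [5]'s lineage IS the degree-2 component of (34)/(35)), whence **`rem_four_eq`**: [5]'s third-order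
  remainder `rem [Y₁, …, Y₄]` (= `Πe^{Yᵢ} − 1 − ΣYᵢ − quad`) `= grade4 3 + (Πe^{Yᵢ} − Σ_{N<4} grade4 N)` — the split
  (29)/(30)/(35) into the third-order term and the terms of order `≧ 4`.
* §2 **(26)**: `V0 T U η d τ A := A(U₁U₀) − A(U₀) − ⟨A, J⟩ − ½⟨A, ΔA⟩` (V₀ is DEFINED by (26), in the analytic form
  of its linear term; `eq26`); **`V0_eq_sum_rem3`**: `V₀(A) = η^{d−4}Σ_p ρ_p` ([5] (3.12) = `B9Eq39Adjoint.eq312`) —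
  i.e. V₀ IS the third-order Taylor remainder; **`eq26_printed`**: for HERMITIAN `A`, a UNITARY background and a
  `*`-compatible trace the display (26) LETTER FOR LETTER, linear term `Σ_p η^{d−2} Im tr(DA)(p)U₀(∂p)` (by (27) =
  `B11Eq27Current.eq27`).  Per plaquette: `V0p` (= `V₀(A, ∂p) := η⁻⁴ρ_p`), `V3p` (= `V⁽³⁾(A, ∂p)`, the degree-3
  component of `Π_b exp iηA′(b)` against `U₀(∂p)` in the complexified `Re tr` reading of [5]), `V4p` (= `V₄(A, ∂p)`,
  the components of degree `≧ 4`), totals `V3`, `V4`; **`eq30a`** `V₀(A) = Σ_p η^d V₀(A, ∂p)`, **`eq30b`**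
  `V₀(A, ∂p) = V⁽³⁾(A, ∂p) + V₄(A, ∂p)`, **`eq29`** `V₀(A) = V⁽³⁾(A) + V₄(A)`.
* §3 «the expansion of V₀(A) begins with a third order polynomial», quantitatively: **`norm_V0p_le`**/**`norm_V0_le`**
  (`‖V₀(A, ∂p)‖ ≦ |η|⁻⁴·½‖τ‖(‖U₀(∂p)‖ + ‖U₀(∂p)⁻¹‖)·T₃(|η|·|A|(∂p))`, `T₃(t) = eᵗ − 1 − t − t²/2 ≦ (t³/6)eᵗ`, from
  `B9Eq39Adjoint.norm_rem3_le`), the cubic forms `…_cubic`, and **`norm_V0_smul_le`**: `‖V₀(tA)‖ ≦ ‖t‖³·K(A)` for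
  all complex `|t| ≦ 1` (the Taylor expansion of the entire function `t ↦ V₀(tA)` at `0` has no terms of order `< 3`);
  and **`ineq31_V4p`**: the bound (31) `|V₄(A, ∂p)| ≦ (1/4!)(|A|(∂p))⁴e^{η|A|(∂p)}` HOLDS for this file's `V₄(A, ∂p)`
  under the trace estimate `|tr(Z U₀(∂p)^{±1})| ≦ |Z|` (`B11Eq31V4Bound.norm_fourExp_sub_taylor_le` along `∂p` and
  along `−∂p`).
* §4 (v1.1) the Hermitian reading: on the unitary group, for Hermitian `A` and a `*`-trace, **`V3p_eq_re`**
  `V⁽³⁾(A, ∂p) = −η⁻⁴ Re tr(grade4 3 · U₀(∂p))` (the third-order term of (35)) and **`V3p_eq_eq36`**: `V⁽³⁾(A, ∂p)` IS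
  the verbatim (36) (`B11Eq34BCH.V3` at `D = (DA)(p)`, the letters `A′(b)`, `Re U₀(∂p)`, `η⁻² Im U₀(∂p)`), by
  `B11Eq31V4Bound.eq36_of_eq35`.

HONEST SCOPE — what is NOT claimed.  (i) The carrier is [5]'s abstract finite lattice with bijective shifts and an
abstract tracial `τ`; the identification with `T_η ∩ Ω₀`, `η = L^{−k}`, the normalized matrix trace and the domains
`Ω_j` of (1)–(7) is the reader's, exactly as in `B9Eq39Adjoint` (DIVERGENCE D-pv27.4 inherited).  (ii) `Re tr(Z·U₀(∂p))`
is read, as in [5] p. 391 and `B9Eq39Adjoint`, as `½(τ(Z·W) + τ(W⁻¹·Z̃))` with `Z̃` the same expression along the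
reversed contour; for Hermitian `A`, unitary `U₀` and a `*`-trace this is the real part (proved for the linear term via
(27) in `eq26_printed`, for `V⁽³⁾(A, ∂p)` in §4: `V3p_eq_re`, and `V3p_eq_eq36` threads it to the verbatim (36)
`B11Eq34BCH.V3` through `B11Eq31V4Bound.eq36_of_eq35`; for `V₄(A, ∂p)` only the bound (31) is used, in either
reading).  (iii) `d − 4` is a natural-number exponent (`d ≧ 4`).  (iv) No bound of the type (37)–(40)
on `V⁽³⁾`, nothing about the variational problem, Theorem 1 or Propositions 2–9 is touched.  Nothing here is
progress on `Summit.QuantumFields`.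
-/

noncomputable section

open NormedSpace Complex Finset
open scoped Nat

namespace Literature.MathematicalPhysics.QuantumFieldTheory.Balaban1983to89.B11Eq26ActionExpansion

open Literature.MathematicalPhysics.QuantumFieldTheory.Balaban1983to89.Beta.TransportVertices
open Literature.MathematicalPhysics.QuantumFieldTheory.Balaban1983to89.Beta.AdjointTransportJets
open Literature.MathematicalPhysics.QuantumFieldTheory.Balaban1983to89.B9Eq37Insertion
open Literature.MathematicalPhysics.QuantumFieldTheory.Balaban1983to89.B9Eq39Adjoint
open B11Eq34BCH (Z1 prod2 prod3)
open B11Eq31V4Bound (grade4 grade4_zero grade4_one two_smul_grade4_two norm_fourExp_sub_taylor_le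
  norm_I_eta_smul_le)

/-! ## §1 Four letters: [5]'s second-order Taylor data are the components of degree `≦ 2` of (34)/(35) -/

section FourLetters

variable {𝔸 : Type*} [NormedRing 𝔸] [NormedAlgebra ℂ 𝔸]

omit [NormedAlgebra ℂ 𝔸] in
/-- `Π_{b⊂(∂p)_z} exp Y(b) = e^{Y₁}e^{Y₂}e^{Y₃}e^{Y₄}` ((34), the ordered product of the four exponentials).
[cite: Balaban1985Variational, (34) p.283] -/
theorem holonomy_four (Y₁ Y₂ Y₃ Y₄ : 𝔸) :
    holonomy [Y₁, Y₂, Y₃, Y₄] = exp Y₁ * exp Y₂ * exp Y₃ * exp Y₄ := by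
  simp [holonomy, mul_assoc]

omit [NormedAlgebra ℂ 𝔸] in
/-- The first-order datum: `ΣYᵢ = Z₁` ((34)). [cite: Balaban1985Variational, (34) p.283] -/
theorem sum_four (Y₁ Y₂ Y₃ Y₄ : 𝔸) : [Y₁, Y₂, Y₃, Y₄].sum = Z1 Y₁ Y₂ Y₃ Y₄ := by
  simp only [List.sum_cons, List.sum_nil, add_zero, Z1]
  abel

/-- `2·quad [Y₁, …, Y₄] = ΣYᵢ² + 2Σ_{i≺j}YᵢYⱼ = prod2` ([5]'s `quad = ½(σ² + Σ_{i≺j}[Yᵢ, Yⱼ])`).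
[cite: Balaban1985Variational, (34) p.283] -/
theorem two_smul_quad_four (Y₁ Y₂ Y₃ Y₄ : 𝔸) :
    (2 : ℂ) • quad ℂ [Y₁, Y₂, Y₃, Y₄] = prod2 Y₁ Y₂ Y₃ Y₄ := by
  rw [two_smul_quad ℂ]
  simp only [List.sum_cons, List.sum_nil, add_zero, commSum_cons, commSum_nil, zero_add, prod2]
  noncomm_ring

/-- `2·grade4 2 = prod2`, with the complex scalar. [cite: Balaban1985Variational, (34) p.283] -/
theorem two_smul_grade4_two_complex (Y₁ Y₂ Y₃ Y₄ : 𝔸) :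
    (2 : ℂ) • grade4 Y₁ Y₂ Y₃ Y₄ 2 = prod2 Y₁ Y₂ Y₃ Y₄ := by
  have h := two_smul_grade4_two Y₁ Y₂ Y₃ Y₄
  rw [show (2 : ℝ) = ((2 : ℕ) : ℝ) by norm_num, Nat.cast_smul_eq_nsmul] at h
  rw [show (2 : ℂ) = ((2 : ℕ) : ℂ) by norm_num, Nat.cast_smul_eq_nsmul]
  exact h

/-- THE SECOND-ORDER DATUM OF [5] IS THE DEGREE-2 COMPONENT OF (34): `quad [Y₁, …, Y₄] = grade4 2`.
[cite: Balaban1985Variational, (34)-(35) p.283] -/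
theorem quad_four_eq_grade4_two (Y₁ Y₂ Y₃ Y₄ : 𝔸) :
    quad ℂ [Y₁, Y₂, Y₃, Y₄] = grade4 Y₁ Y₂ Y₃ Y₄ 2 := by
  have h : (2 : ℂ) • quad ℂ [Y₁, Y₂, Y₃, Y₄] = (2 : ℂ) • grade4 Y₁ Y₂ Y₃ Y₄ 2 := by
    rw [two_smul_quad_four, two_smul_grade4_two_complex]
  have h' := congrArg (fun Z : 𝔸 => (2 : ℂ)⁻¹ • Z) h
  simpa only [inv_smul_smul₀ (two_ne_zero : (2 : ℂ) ≠ 0)] using h'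

/-- The terms of order `≧ 4` of `e^{Y₁}e^{Y₂}e^{Y₃}e^{Y₄}` (`R₄` of (31)/(35): the product minus its components of
degree `< 4`). [cite: Balaban1985Variational, (31) p.282, (35) p.283] -/
def tail4 (Y₁ Y₂ Y₃ Y₄ : 𝔸) : 𝔸 :=
  exp Y₁ * exp Y₂ * exp Y₃ * exp Y₄ - ∑ N ∈ range 4, grade4 Y₁ Y₂ Y₃ Y₄ N

/-- `tail4` unfolded. [cite: Balaban1985Variational, (35) p.283] -/
theorem tail4_def (Y₁ Y₂ Y₃ Y₄ : 𝔸) :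
    tail4 Y₁ Y₂ Y₃ Y₄ = exp Y₁ * exp Y₂ * exp Y₃ * exp Y₄ - ∑ N ∈ range 4, grade4 Y₁ Y₂ Y₃ Y₄ N := rfl

/-- **THE SPLIT (29)/(30)/(35) AT THE LEVEL OF THE FOUR LETTERS**: [5]'s third-order remainder
`rem [Y₁, …, Y₄] = Πe^{Yᵢ} − 1 − ΣYᵢ − quad` equals (degree-3 component) + (terms of order ≧ 4).
[cite: Balaban1985Variational, (29)-(30) p.282, (35) p.283] -/
theorem rem_four_eq (Y₁ Y₂ Y₃ Y₄ : 𝔸) :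
    rem [Y₁, Y₂, Y₃, Y₄] = grade4 Y₁ Y₂ Y₃ Y₄ 3 + tail4 Y₁ Y₂ Y₃ Y₄ := by
  rw [rem, holonomy_four, sum_four, quad_four_eq_grade4_two, tail4]
  simp only [Finset.sum_range_succ, Finset.sum_range_zero, zero_add, grade4_zero, grade4_one]
  abel

omit [NormedAlgebra ℂ 𝔸] in
/-- The reversed contour: `invPath [Y₁, Y₂, Y₃, Y₄] = [−Y₄, −Y₃, −Y₂, −Y₁]`. [cite: Balaban1985Variational, (34) p.283] -/
theorem invPath_four (Y₁ Y₂ Y₃ Y₄ : 𝔸) : invPath [Y₁, Y₂, Y₃, Y₄] = [-Y₄, -Y₃, -Y₂, -Y₁] := by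
  simp [invPath]

end FourLetters

/-! ## §2 (26), (29), (30) on the lattice of [5] -/

section Lattice

variable {𝔸 : Type*} [NormedRing 𝔸] [NormedAlgebra ℂ 𝔸] [CompleteSpace 𝔸]
variable {S : Type*} [Fintype S] {ι : Type*} [Fintype ι] [LinearOrder ι]
variable (T : ι → Equiv.Perm S) (U : ι → S → 𝔸ˣ)

/-- **`V₀(A)` DEFINED BY (26)**: `V₀(A) := A(U₁U₀) − A(U₀) − ⟨A, J⟩ − ½⟨A, ΔA⟩`, `U₁ = exp iηA`, with the linear term
in its analytic form `⟨A, J⟩` ((27)) so that `V₀` is an entire function of the complexified `A`, as the print requires.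
[cite: Balaban1985Variational, (26) p.282] -/
def V0 (η : ℝ) (d : ℕ) (τ : 𝔸 →ₗ[ℂ] ℂ) (A : ι → S → 𝔸) : ℂ :=
  action T η d τ (prodCfg U η A) - action T η d τ U - bondPair η d τ A (J T U η) - 2⁻¹ * hessPair T U η d τ A

/-- **(26)**: `A(U₁U₀) = A(U₀) + ⟨A, J⟩ + ½⟨A, ΔA⟩ + V₀(A)`. [cite: Balaban1985Variational, (26) p.282] -/
theorem eq26 (η : ℝ) (d : ℕ) (τ : 𝔸 →ₗ[ℂ] ℂ) (A : ι → S → 𝔸) :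
    action T η d τ (prodCfg U η A)
      = action T η d τ U + bondPair η d τ A (J T U η) + 2⁻¹ * hessPair T U η d τ A + V0 T U η d τ A := by
  unfold V0
  ring

/-- **V₀ IS THE THIRD-ORDER TAYLOR REMAINDER** («the expansion of V₀(A) begins with a third order polynomial»):
`V₀(A) = η^{d−4}Σ_{p} ρ_p` with [5]'s per-plaquette third-order remainder `ρ_p = B9Eq39Adjoint.rem3` — (3.12) of [5]
(`B9Eq39Adjoint.eq312`). [cite: Balaban1985Variational, (26) p.282] -/
theorem V0_eq_sum_rem3 (τ : 𝔸 →ₗ[ℂ] ℂ) (hτ : ∀ a b : 𝔸, τ (a * b) = τ (b * a)) (η : ℝ) (hη : η ≠ 0) {d : ℕ}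
    (hd : 4 ≤ d) (A : ι → S → 𝔸) :
    V0 T U η d τ A = (η : ℂ) ^ (d - 4) * ∑ q ∈ posPlaq S ι, rem3 T U η τ A q.2.1 q.2.2 q.1 := by
  unfold V0
  rw [eq312 T U τ hτ η hη hd A]
  ring

/-- **(26) LETTER FOR LETTER**: for a HERMITIAN `A`, a UNITARY background (`U(b)⁻¹ = U(b)*`) and a tracial `*`-compatible
`τ`, `A(U₁U₀) = A(U₀) + Σ_p η^{d−2} Im tr(DA)(p)U₀(∂p) + ½⟨A, ΔA⟩ + V₀(A)` — the linear term in the printed `Im tr` form,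
converted by (27) (`B11Eq27Current.eq27`). [cite: Balaban1985Variational, (26)-(27) p.282] -/
theorem eq26_printed [StarRing 𝔸] [StarModule ℂ 𝔸] (hU : ∀ μ x, (((U μ x)⁻¹ : 𝔸ˣ) : 𝔸) = star (U μ x : 𝔸))
    (τ : 𝔸 →ₗ[ℂ] ℂ) (hτ : ∀ a b : 𝔸, τ (a * b) = τ (b * a)) (hτs : ∀ a : 𝔸, τ (star a) = starRingEnd ℂ (τ a))
    (η : ℝ) (d : ℕ) {A : ι → S → 𝔸} (hA : ∀ μ x, star (A μ x) = A μ x) :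
    action T η d τ (prodCfg U η A)
      = action T η d τ U
        + (η : ℂ) ^ d * ∑ q ∈ posPlaq S ι, ((η : ℂ)⁻¹) ^ 2 *
            (((τ (curlη T U η A q.2.1 q.2.2 q.1 * (plaqU T U q.2.1 q.2.2 q.1 : 𝔸))).im : ℝ) : ℂ)
        + 2⁻¹ * hessPair T U η d τ A + V0 T U η d τ A := by
  obtain ⟨h1, h2⟩ := B11Eq27Current.eq27 T U hU τ hτ hτs η d hA
  rw [h1, h2]
  exact eq26 T U η d τ A

/-! ### The per-plaquette objects of (30) -/

/-- The four exponents of (34) in contour order, `Y(b) = iηA′(b)`, `b ⊂ ∂(p)_z` (the letters `A′(b)` of [5] (3.2) are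
`B9Eq39Adjoint.lettersA`). [cite: Balaban1985Variational, (34) p.283, (25) p.282] -/
def Y (η : ℝ) (A : ι → S → 𝔸) (μ ν : ι) (x : S) : Fin 4 → 𝔸 :=
  ![((I * η : ℂ)) • (-(R (U ν x) (A μ (T ν x)))), ((I * η : ℂ)) • (-(A ν x)), ((I * η : ℂ)) • A μ x,
    ((I * η : ℂ)) • R (U μ x) (A ν (T μ x))]

omit [CompleteSpace 𝔸] [Fintype S] [Fintype ι] [LinearOrder ι] in
/-- The exponents ARE [5]'s scaled letters: `letters η (lettersA A p) = [Y₀, Y₁, Y₂, Y₃]`.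
[cite: Balaban1985Variational, (34) p.283] -/
theorem letters_lettersA (η : ℝ) (A : ι → S → 𝔸) (μ ν : ι) (x : S) :
    letters η (lettersA T U A μ ν x)
      = [Y T U η A μ ν x 0, Y T U η A μ ν x 1, Y T U η A μ ν x 2, Y T U η A μ ν x 3] := by
  simp [letters, lettersA, Y]

/-- **`V₀(A, ∂p)`** of (30): `η⁻⁴ρ_p` (so that `V₀(A) = Σ_p η^d V₀(A, ∂p)`, `eq30a`).
[cite: Balaban1985Variational, (30) p.282] -/
def V0p (η : ℝ) (τ : 𝔸 →ₗ[ℂ] ℂ) (A : ι → S → 𝔸) (μ ν : ι) (x : S) : ℂ :=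
  ((η : ℂ)⁻¹) ^ 4 * rem3 T U η τ A μ ν x

/-- **`V⁽³⁾(A, ∂p)`** of (30)/(35): `η⁻⁴ ×` the total-degree-3 component of `∂₀U₁((p)_z) = Π_b exp iηA′(b)` against
`U₀(∂p)`, in the complexified `−Re tr` reading of [5] (`−½[τ(Z·W) + τ(W⁻¹·Z̃)]`, `Z̃` along the reversed contour).
[cite: Balaban1985Variational, (30) p.282, (35) p.283] -/
def V3p (η : ℝ) (τ : 𝔸 →ₗ[ℂ] ℂ) (A : ι → S → 𝔸) (μ ν : ι) (x : S) : ℂ :=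
  ((η : ℂ)⁻¹) ^ 4 * (-(2 : ℂ)⁻¹ *
    (τ (grade4 (Y T U η A μ ν x 0) (Y T U η A μ ν x 1) (Y T U η A μ ν x 2) (Y T U η A μ ν x 3) 3
        * (plaqU T U μ ν x : 𝔸))
      + τ ((((plaqU T U μ ν x)⁻¹ : 𝔸ˣ) : 𝔸)
        * grade4 (-Y T U η A μ ν x 3) (-Y T U η A μ ν x 2) (-Y T U η A μ ν x 1) (-Y T U η A μ ν x 0) 3)))

/-- **`V₄(A, ∂p)`** of (30)/(35): `η⁻⁴ ×` the components of total degree `≧ 4` of `∂₀U₁((p)_z)` against `U₀(∂p)`, in the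
same reading. [cite: Balaban1985Variational, (30)-(31) p.282, (35) p.283] -/
def V4p (η : ℝ) (τ : 𝔸 →ₗ[ℂ] ℂ) (A : ι → S → 𝔸) (μ ν : ι) (x : S) : ℂ :=
  ((η : ℂ)⁻¹) ^ 4 * (-(2 : ℂ)⁻¹ *
    (τ (tail4 (Y T U η A μ ν x 0) (Y T U η A μ ν x 1) (Y T U η A μ ν x 2) (Y T U η A μ ν x 3)
        * (plaqU T U μ ν x : 𝔸))
      + τ ((((plaqU T U μ ν x)⁻¹ : 𝔸ˣ) : 𝔸)
        * tail4 (-Y T U η A μ ν x 3) (-Y T U η A μ ν x 2) (-Y T U η A μ ν x 1) (-Y T U η A μ ν x 0))))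

omit [CompleteSpace 𝔸] [Fintype S] [Fintype ι] [LinearOrder ι] in
/-- **(30), second display**: `V₀(A, ∂p) = V⁽³⁾(A, ∂p) + V₄(A, ∂p)`. [cite: Balaban1985Variational, (30) p.282] -/
theorem eq30b (η : ℝ) (τ : 𝔸 →ₗ[ℂ] ℂ) (A : ι → S → 𝔸) (μ ν : ι) (x : S) :
    V0p T U η τ A μ ν x = V3p T U η τ A μ ν x + V4p T U η τ A μ ν x := by
  unfold V0p V3p V4p
  rw [rem3, letters_lettersA, invPath_four, rem_four_eq, rem_four_eq]
  simp only [mul_add, add_mul, map_add]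
  ring

/-- `η^{d−4} = η^d·η⁻⁴` for `η ≠ 0`, `d ≧ 4`. [cite: Balaban1985Variational, (26) p.282, (30) p.282] -/
theorem pow_sub_four {η : ℝ} (hη : η ≠ 0) {d : ℕ} (hd : 4 ≤ d) :
    (η : ℂ) ^ (d - 4) = (η : ℂ) ^ d * ((η : ℂ)⁻¹) ^ 4 := by
  rw [inv_pow, pow_sub₀ _ (Complex.ofReal_ne_zero.2 hη) hd]

/-- **(30), first display**: `V₀(A) = Σ_p η^d V₀(A, ∂p)`. [cite: Balaban1985Variational, (30) p.282] -/
theorem eq30a (τ : 𝔸 →ₗ[ℂ] ℂ) (hτ : ∀ a b : 𝔸, τ (a * b) = τ (b * a)) (η : ℝ) (hη : η ≠ 0) {d : ℕ} (hd : 4 ≤ d)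
    (A : ι → S → 𝔸) :
    V0 T U η d τ A = ∑ q ∈ posPlaq S ι, (η : ℂ) ^ d * V0p T U η τ A q.2.1 q.2.2 q.1 := by
  rw [V0_eq_sum_rem3 T U τ hτ η hη hd A, pow_sub_four hη hd, Finset.mul_sum]
  refine Finset.sum_congr rfl fun q _ => ?_
  unfold V0p
  ring

/-- **`V⁽³⁾(A) := Σ_p η^d V⁽³⁾(A, ∂p)`** (29)/(30). [cite: Balaban1985Variational, (29)-(30) p.282] -/
def V3 (η : ℝ) (d : ℕ) (τ : 𝔸 →ₗ[ℂ] ℂ) (A : ι → S → 𝔸) : ℂ :=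
  ∑ q ∈ posPlaq S ι, (η : ℂ) ^ d * V3p T U η τ A q.2.1 q.2.2 q.1

/-- **`V₄(A) := Σ_p η^d V₄(A, ∂p)`** (29)/(30). [cite: Balaban1985Variational, (29)-(30) p.282] -/
def V4 (η : ℝ) (d : ℕ) (τ : 𝔸 →ₗ[ℂ] ℂ) (A : ι → S → 𝔸) : ℂ :=
  ∑ q ∈ posPlaq S ι, (η : ℂ) ^ d * V4p T U η τ A q.2.1 q.2.2 q.1

/-- **(29)**: `V₀(A) = V⁽³⁾(A) + V₄(A)`. [cite: Balaban1985Variational, (29) p.282] -/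
theorem eq29 (τ : 𝔸 →ₗ[ℂ] ℂ) (hτ : ∀ a b : 𝔸, τ (a * b) = τ (b * a)) (η : ℝ) (hη : η ≠ 0) {d : ℕ} (hd : 4 ≤ d)
    (A : ι → S → 𝔸) :
    V0 T U η d τ A = V3 T U η d τ A + V4 T U η d τ A := by
  rw [eq30a T U τ hτ η hη hd A, V3, V4, ← Finset.sum_add_distrib]
  refine Finset.sum_congr rfl fun q _ => ?_
  rw [eq30b, mul_add]

/-! ## §3 «The expansion of V₀(A) begins with a third order polynomial»: the cubic bounds; (31) for `V₄(A, ∂p)` -/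

omit [Fintype S] [Fintype ι] [LinearOrder ι] in
/-- PER PLAQUETTE: `‖V₀(A, ∂p)‖ ≦ |η|⁻⁴·½‖τ‖(‖U₀(∂p)‖ + ‖U₀(∂p)⁻¹‖)·T₃(|η|·Σ_b‖A′(b)‖)`, `T₃(t) = eᵗ − 1 − t − t²/2`
(`B9Eq39Adjoint.norm_rem3_le`). [cite: Balaban1985Variational, (26) p.282, (30) p.282] -/
theorem norm_V0p_le (τ : 𝔸 →L[ℂ] ℂ) (η : ℝ) (A : ι → S → 𝔸) (μ ν : ι) (x : S) :
    ‖V0p T U η (τ : 𝔸 →ₗ[ℂ] ℂ) A μ ν x‖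
      ≤ (|η|⁻¹) ^ 4 * (2⁻¹ * ‖τ‖ * (‖(plaqU T U μ ν x : 𝔸)‖ + ‖(((plaqU T U μ ν x)⁻¹ : 𝔸ˣ) : 𝔸)‖)
          * expTail 3 (|η| * size (lettersA T U A μ ν x))) := by
  unfold V0p
  rw [norm_mul, norm_pow, norm_inv, Complex.norm_real, Real.norm_eq_abs]
  exact mul_le_mul_of_nonneg_left (norm_rem3_le T U τ η A μ ν x) (by positivity)

omit [Fintype S] [Fintype ι] [LinearOrder ι] in
/-- The CUBIC form: `‖V₀(A, ∂p)‖ ≦ |η|⁻⁴·½‖τ‖(‖U₀(∂p)‖ + ‖U₀(∂p)⁻¹‖)·((|η|s)³/6)e^{|η|s}`, `s = Σ_b‖A′(b)‖`.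
[cite: Balaban1985Variational, (26) p.282, (30) p.282] -/
theorem norm_V0p_le_cubic (τ : 𝔸 →L[ℂ] ℂ) (η : ℝ) (A : ι → S → 𝔸) (μ ν : ι) (x : S) :
    ‖V0p T U η (τ : 𝔸 →ₗ[ℂ] ℂ) A μ ν x‖
      ≤ (|η|⁻¹) ^ 4 * (2⁻¹ * ‖τ‖ * (‖(plaqU T U μ ν x : 𝔸)‖ + ‖(((plaqU T U μ ν x)⁻¹ : 𝔸ˣ) : 𝔸)‖)
          * ((|η| * size (lettersA T U A μ ν x)) ^ 3 / 6
              * Real.exp (|η| * size (lettersA T U A μ ν x)))) := by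
  refine (norm_V0p_le T U τ η A μ ν x).trans ?_
  have hs : 0 ≤ |η| * size (lettersA T U A μ ν x) := mul_nonneg (abs_nonneg η) (size_nonneg _)
  gcongr
  exact expTail_three_le hs

/-- THE WHOLE REMAINDER: `‖V₀(A)‖ ≦ |η|^{d−4}Σ_p ½‖τ‖(‖U₀(∂p)‖ + ‖U₀(∂p)⁻¹‖)·T₃(|η|·Σ_b‖A′(b)‖)` — third order in `A`.
[cite: Balaban1985Variational, (26) p.282] -/
theorem norm_V0_le (τ : 𝔸 →L[ℂ] ℂ) (hτ : ∀ a b : 𝔸, τ (a * b) = τ (b * a)) (η : ℝ) (hη : η ≠ 0) {d : ℕ}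
    (hd : 4 ≤ d) (A : ι → S → 𝔸) :
    ‖V0 T U η d (τ : 𝔸 →ₗ[ℂ] ℂ) A‖
      ≤ |η| ^ (d - 4) * ∑ q ∈ posPlaq S ι,
          2⁻¹ * ‖τ‖ * (‖(plaqU T U q.2.1 q.2.2 q.1 : 𝔸)‖ + ‖(((plaqU T U q.2.1 q.2.2 q.1)⁻¹ : 𝔸ˣ) : 𝔸)‖)
            * expTail 3 (|η| * size (lettersA T U A q.2.1 q.2.2 q.1)) := by
  rw [V0_eq_sum_rem3 T U (τ : 𝔸 →ₗ[ℂ] ℂ) hτ η hη hd A, norm_mul, norm_pow, Complex.norm_real, Real.norm_eq_abs]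
  refine mul_le_mul_of_nonneg_left ((norm_sum_le _ _).trans (Finset.sum_le_sum fun q _ => ?_)) (by positivity)
  exact norm_rem3_le T U τ η A q.2.1 q.2.2 q.1

/-- The CUBIC form of `norm_V0_le`. [cite: Balaban1985Variational, (26) p.282] -/
theorem norm_V0_le_cubic (τ : 𝔸 →L[ℂ] ℂ) (hτ : ∀ a b : 𝔸, τ (a * b) = τ (b * a)) (η : ℝ) (hη : η ≠ 0) {d : ℕ}
    (hd : 4 ≤ d) (A : ι → S → 𝔸) :
    ‖V0 T U η d (τ : 𝔸 →ₗ[ℂ] ℂ) A‖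
      ≤ |η| ^ (d - 4) * ∑ q ∈ posPlaq S ι,
          2⁻¹ * ‖τ‖ * (‖(plaqU T U q.2.1 q.2.2 q.1 : 𝔸)‖ + ‖(((plaqU T U q.2.1 q.2.2 q.1)⁻¹ : 𝔸ˣ) : 𝔸)‖)
            * ((|η| * size (lettersA T U A q.2.1 q.2.2 q.1)) ^ 3 / 6
                * Real.exp (|η| * size (lettersA T U A q.2.1 q.2.2 q.1))) := by
  refine (norm_V0_le T U τ hτ η hη hd A).trans ?_
  gcongr with q _
  exact expTail_three_le (mul_nonneg (abs_nonneg η) (size_nonneg _))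

/-! ### `V₀(tA) = O(t³)`: the Taylor expansion of the entire function `t ↦ V₀(tA)` has no terms of order `< 3` -/

omit [CompleteSpace 𝔸] [Fintype S] [Fintype ι] [LinearOrder ι] in
/-- The letters are linear in `A`: `A′(b)[tA] = t·A′(b)[A]` (the transports `R(U₀(b))` are linear).
[cite: Balaban1985Variational, (25) p.282] -/
theorem lettersA_smul (t : ℂ) (A : ι → S → 𝔸) (μ ν : ι) (x : S) :
    lettersA T U (t • A) μ ν x = (lettersA T U A μ ν x).map (t • ·) := by
  simp [lettersA, R_smul, smul_neg]

/-- **«THE EXPANSION OF V₀(A) BEGINS WITH A THIRD ORDER POLYNOMIAL»** as a statement about the entire function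
`t ↦ V₀(tA)` of the complex variable `t`: `‖V₀(tA)‖ ≦ ‖t‖³·K(A)` for `‖t‖ ≦ 1`, with the explicit
`K(A) = |η|^{d−4}Σ_p ½‖τ‖(‖U₀(∂p)‖ + ‖U₀(∂p)⁻¹‖)((|η|s_p)³/6)e^{|η|s_p}`, `s_p = Σ_{b⊂∂p}‖A′(b)‖`.
[cite: Balaban1985Variational, (26) p.282] -/
theorem norm_V0_smul_le (τ : 𝔸 →L[ℂ] ℂ) (hτ : ∀ a b : 𝔸, τ (a * b) = τ (b * a)) (η : ℝ) (hη : η ≠ 0) {d : ℕ}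
    (hd : 4 ≤ d) (A : ι → S → 𝔸) {t : ℂ} (ht : ‖t‖ ≤ 1) :
    ‖V0 T U η d (τ : 𝔸 →ₗ[ℂ] ℂ) (t • A)‖
      ≤ ‖t‖ ^ 3 * (|η| ^ (d - 4) * ∑ q ∈ posPlaq S ι,
          2⁻¹ * ‖τ‖ * (‖(plaqU T U q.2.1 q.2.2 q.1 : 𝔸)‖ + ‖(((plaqU T U q.2.1 q.2.2 q.1)⁻¹ : 𝔸ˣ) : 𝔸)‖)
            * ((|η| * size (lettersA T U A q.2.1 q.2.2 q.1)) ^ 3 / 6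
                * Real.exp (|η| * size (lettersA T U A q.2.1 q.2.2 q.1)))) := by
  have key : ∀ q ∈ posPlaq S ι,
      2⁻¹ * ‖τ‖ * (‖(plaqU T U q.2.1 q.2.2 q.1 : 𝔸)‖ + ‖(((plaqU T U q.2.1 q.2.2 q.1)⁻¹ : 𝔸ˣ) : 𝔸)‖)
          * ((|η| * size (lettersA T U (t • A) q.2.1 q.2.2 q.1)) ^ 3 / 6
              * Real.exp (|η| * size (lettersA T U (t • A) q.2.1 q.2.2 q.1)))
        ≤ ‖t‖ ^ 3 * (2⁻¹ * ‖τ‖ * (‖(plaqU T U q.2.1 q.2.2 q.1 : 𝔸)‖ + ‖(((plaqU T U q.2.1 q.2.2 q.1)⁻¹ : 𝔸ˣ) : 𝔸)‖)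
          * ((|η| * size (lettersA T U A q.2.1 q.2.2 q.1)) ^ 3 / 6
              * Real.exp (|η| * size (lettersA T U A q.2.1 q.2.2 q.1)))) := by
    intro q _
    rw [lettersA_smul, size_map_smul]
    have hs : 0 ≤ size (lettersA T U A q.2.1 q.2.2 q.1) := size_nonneg _
    have h1 : ‖t‖ * size (lettersA T U A q.2.1 q.2.2 q.1) ≤ size (lettersA T U A q.2.1 q.2.2 q.1) :=
      mul_le_of_le_one_left hs ht
    have hexp : Real.exp (|η| * (‖t‖ * size (lettersA T U A q.2.1 q.2.2 q.1)))
        ≤ Real.exp (|η| * size (lettersA T U A q.2.1 q.2.2 q.1)) :=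
      Real.exp_le_exp.2 (mul_le_mul_of_nonneg_left h1 (abs_nonneg η))
    calc 2⁻¹ * ‖τ‖ * (‖(plaqU T U q.2.1 q.2.2 q.1 : 𝔸)‖ + ‖(((plaqU T U q.2.1 q.2.2 q.1)⁻¹ : 𝔸ˣ) : 𝔸)‖)
          * ((|η| * (‖t‖ * size (lettersA T U A q.2.1 q.2.2 q.1))) ^ 3 / 6
              * Real.exp (|η| * (‖t‖ * size (lettersA T U A q.2.1 q.2.2 q.1))))
        ≤ 2⁻¹ * ‖τ‖ * (‖(plaqU T U q.2.1 q.2.2 q.1 : 𝔸)‖ + ‖(((plaqU T U q.2.1 q.2.2 q.1)⁻¹ : 𝔸ˣ) : 𝔸)‖)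
          * ((|η| * (‖t‖ * size (lettersA T U A q.2.1 q.2.2 q.1))) ^ 3 / 6
              * Real.exp (|η| * size (lettersA T U A q.2.1 q.2.2 q.1))) := by gcongr
      _ = ‖t‖ ^ 3 * (2⁻¹ * ‖τ‖ * (‖(plaqU T U q.2.1 q.2.2 q.1 : 𝔸)‖ + ‖(((plaqU T U q.2.1 q.2.2 q.1)⁻¹ : 𝔸ˣ) : 𝔸)‖)
          * ((|η| * size (lettersA T U A q.2.1 q.2.2 q.1)) ^ 3 / 6
              * Real.exp (|η| * size (lettersA T U A q.2.1 q.2.2 q.1)))) := by ring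
  calc ‖V0 T U η d (τ : 𝔸 →ₗ[ℂ] ℂ) (t • A)‖
      ≤ |η| ^ (d - 4) * ∑ q ∈ posPlaq S ι,
          2⁻¹ * ‖τ‖ * (‖(plaqU T U q.2.1 q.2.2 q.1 : 𝔸)‖ + ‖(((plaqU T U q.2.1 q.2.2 q.1)⁻¹ : 𝔸ˣ) : 𝔸)‖)
            * ((|η| * size (lettersA T U (t • A) q.2.1 q.2.2 q.1)) ^ 3 / 6
                * Real.exp (|η| * size (lettersA T U (t • A) q.2.1 q.2.2 q.1))) :=
        norm_V0_le_cubic T U τ hτ η hη hd (t • A)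
    _ ≤ |η| ^ (d - 4) * ∑ q ∈ posPlaq S ι,
          ‖t‖ ^ 3 * (2⁻¹ * ‖τ‖ * (‖(plaqU T U q.2.1 q.2.2 q.1 : 𝔸)‖ + ‖(((plaqU T U q.2.1 q.2.2 q.1)⁻¹ : 𝔸ˣ) : 𝔸)‖)
            * ((|η| * size (lettersA T U A q.2.1 q.2.2 q.1)) ^ 3 / 6
                * Real.exp (|η| * size (lettersA T U A q.2.1 q.2.2 q.1)))) :=
        mul_le_mul_of_nonneg_left (Finset.sum_le_sum key) (by positivity)
    _ = _ := by rw [← Finset.mul_sum]; ring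

/-! ### (31) holds for this `V₄(A, ∂p)` -/

omit [CompleteSpace 𝔸] [Fintype S] [Fintype ι] [LinearOrder ι] in
/-- The entries of `Y`. [cite: Balaban1985Variational, (34) p.283] -/
theorem Y_apply (η : ℝ) (A : ι → S → 𝔸) (μ ν : ι) (x : S) :
    Y T U η A μ ν x 0 = ((I * η : ℂ)) • (-(R (U ν x) (A μ (T ν x)))) ∧
    Y T U η A μ ν x 1 = ((I * η : ℂ)) • (-(A ν x)) ∧
    Y T U η A μ ν x 2 = ((I * η : ℂ)) • A μ x ∧
    Y T U η A μ ν x 3 = ((I * η : ℂ)) • R (U μ x) (A ν (T μ x)) :=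
  ⟨rfl, rfl, rfl, rfl⟩

omit [Fintype S] [Fintype ι] [LinearOrder ι] in
/-- **(31) FOR THIS FILE'S `V₄(A, ∂p)`**: under the trace estimates `|tr(Z·U₀(∂p))| ≦ |Z|`, `|tr(Z·U₀(∂p)⁻¹)| ≦ |Z|`
(unitary `U₀(∂p)`, normalized trace), `η > 0` and majorants `|A′(bᵢ)| ≦ aᵢ`, `|A|(∂p) = Σaᵢ`:
`|V₄(A, ∂p)| ≦ (1/4!)(|A|(∂p))⁴e^{η|A|(∂p)}` — the four-exponential remainder bound of `B11Eq31V4Bound` along `∂p`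
and along `−∂p`. [cite: Balaban1985Variational, (31) p.282] -/
theorem ineq31_V4p [NormOneClass 𝔸] (τ : 𝔸 →ₗ[ℂ] ℂ) (hτ : ∀ a b : 𝔸, τ (a * b) = τ (b * a)) (μ ν : ι) (x : S)
    (hW : ∀ Z : 𝔸, ‖τ (Z * (plaqU T U μ ν x : 𝔸))‖ ≤ ‖Z‖)
    (hW' : ∀ Z : 𝔸, ‖τ (Z * (((plaqU T U μ ν x)⁻¹ : 𝔸ˣ) : 𝔸))‖ ≤ ‖Z‖)
    {η : ℝ} (hη : 0 < η) {A : ι → S → 𝔸} {a₁ a₂ a₃ a₄ : ℝ}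
    (h₁ : ‖R (U ν x) (A μ (T ν x))‖ ≤ a₁) (h₂ : ‖A ν x‖ ≤ a₂) (h₃ : ‖A μ x‖ ≤ a₃)
    (h₄ : ‖R (U μ x) (A ν (T μ x))‖ ≤ a₄) :
    ‖V4p T U η τ A μ ν x‖ ≤ 1 / 4 ! * (a₁ + a₂ + a₃ + a₄) ^ 4 * Real.exp (η * (a₁ + a₂ + a₃ + a₄)) := by
  obtain ⟨e0, e1, e2, e3⟩ := Y_apply T U η A μ ν x
  have n0 : ‖Y T U η A μ ν x 0‖ ≤ η * a₁ := by
    rw [e0, smul_neg, norm_neg]; exact norm_I_eta_smul_le hη.le h₁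
  have n1 : ‖Y T U η A μ ν x 1‖ ≤ η * a₂ := by
    rw [e1, smul_neg, norm_neg]; exact norm_I_eta_smul_le hη.le h₂
  have n2 : ‖Y T U η A μ ν x 2‖ ≤ η * a₃ := by
    rw [e2]; exact norm_I_eta_smul_le hη.le h₃
  have n3 : ‖Y T U η A μ ν x 3‖ ≤ η * a₄ := by
    rw [e3]; exact norm_I_eta_smul_le hη.le h₄
  have m0 : ‖-Y T U η A μ ν x 0‖ ≤ η * a₁ := by rw [norm_neg]; exact n0
  have m1 : ‖-Y T U η A μ ν x 1‖ ≤ η * a₂ := by rw [norm_neg]; exact n1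
  have m2 : ‖-Y T U η A μ ν x 2‖ ≤ η * a₃ := by rw [norm_neg]; exact n2
  have m3 : ‖-Y T U η A μ ν x 3‖ ≤ η * a₄ := by rw [norm_neg]; exact n3
  set s : ℝ := a₁ + a₂ + a₃ + a₄ with hs_def
  have hR := norm_fourExp_sub_taylor_le n0 n1 n2 n3
  have hR' := norm_fourExp_sub_taylor_le m3 m2 m1 m0
  rw [show η * a₁ + η * a₂ + η * a₃ + η * a₄ = η * s by rw [hs_def]; ring] at hR
  rw [show η * a₄ + η * a₃ + η * a₂ + η * a₁ = η * s by rw [hs_def]; ring] at hR'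
  rw [← tail4_def] at hR hR'
  -- the two traces
  have t1 : ‖τ (tail4 (Y T U η A μ ν x 0) (Y T U η A μ ν x 1) (Y T U η A μ ν x 2) (Y T U η A μ ν x 3)
      * (plaqU T U μ ν x : 𝔸))‖ ≤ (η * s) ^ 4 / 4 ! * Real.exp (η * s) := (hW _).trans hR
  have t2 : ‖τ ((((plaqU T U μ ν x)⁻¹ : 𝔸ˣ) : 𝔸)
      * tail4 (-Y T U η A μ ν x 3) (-Y T U η A μ ν x 2) (-Y T U η A μ ν x 1) (-Y T U η A μ ν x 0))‖
        ≤ (η * s) ^ 4 / 4 ! * Real.exp (η * s) := by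
    rw [hτ]; exact (hW' _).trans hR'
  have hsum := (norm_add_le _ _).trans (add_le_add t1 t2)
  unfold V4p
  rw [norm_mul, norm_mul, norm_neg, norm_inv, norm_pow, norm_inv, Complex.norm_real, Real.norm_of_nonneg hη.le,
    Complex.norm_ofNat]
  calc (η⁻¹) ^ 4 * (2⁻¹ * ‖τ (tail4 (Y T U η A μ ν x 0) (Y T U η A μ ν x 1) (Y T U η A μ ν x 2) (Y T U η A μ ν x 3)
            * (plaqU T U μ ν x : 𝔸))
          + τ ((((plaqU T U μ ν x)⁻¹ : 𝔸ˣ) : 𝔸)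
            * tail4 (-Y T U η A μ ν x 3) (-Y T U η A μ ν x 2) (-Y T U η A μ ν x 1) (-Y T U η A μ ν x 0))‖)
      ≤ (η⁻¹) ^ 4 * (2⁻¹ * ((η * s) ^ 4 / 4 ! * Real.exp (η * s) + (η * s) ^ 4 / 4 ! * Real.exp (η * s))) := by
        gcongr
    _ = 1 / 4 ! * s ^ 4 * Real.exp (η * s) := by
        field_simp
        ring

end Lattice

/-! ## §4 The Hermitian reading: `V⁽³⁾(A, ∂p) = −η⁻⁴ Re tr(grade4 3 · U₀(∂p))` on the unitary group, i.e. (36) -/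

section Hermitian

variable {𝔸 : Type*} [NormedRing 𝔸] [NormedAlgebra ℂ 𝔸] [StarRing 𝔸] [StarModule ℂ 𝔸]

omit [NormedAlgebra ℂ 𝔸] [StarModule ℂ 𝔸] in
/-- The involution reverses (34)'s cubic polynomial: `(prod3 Y₁ Y₂ Y₃ Y₄)* = prod3 Y₄* Y₃* Y₂* Y₁*`.
[cite: Balaban1985Variational, (34) p.283] -/
theorem star_prod3 (Y₁ Y₂ Y₃ Y₄ : 𝔸) :
    star (prod3 Y₁ Y₂ Y₃ Y₄) = prod3 (star Y₄) (star Y₃) (star Y₂) (star Y₁) := by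
  simp only [prod3, star_add, star_mul, star_ofNat, mul_assoc]
  noncomm_ring

/-- … hence the degree-3 component: `(grade4 Y₁ Y₂ Y₃ Y₄ 3)* = grade4 Y₄* Y₃* Y₂* Y₁* 3`.
[cite: Balaban1985Variational, (34)-(35) p.283] -/
theorem star_grade4_three (Y₁ Y₂ Y₃ Y₄ : 𝔸) :
    star (grade4 Y₁ Y₂ Y₃ Y₄ 3) = grade4 (star Y₄) (star Y₃) (star Y₂) (star Y₁) 3 := by
  have e : ∀ Z : 𝔸, Z = (12 : ℂ)⁻¹ • ((12 : ℂ) • Z) := fun Z =>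
    (inv_smul_smul₀ (by norm_num : (12 : ℂ) ≠ 0) Z).symm
  rw [e (grade4 Y₁ Y₂ Y₃ Y₄ 3), e (grade4 (star Y₄) (star Y₃) (star Y₂) (star Y₁) 3),
    B11Eq31V4Bound.twelve_smul_grade4_three_complex, B11Eq31V4Bound.twelve_smul_grade4_three_complex,
    star_smul, star_prod3]
  congr 1
  rw [star_inv₀]
  norm_num

variable {S : Type*} {ι : Type*} (T : ι → Equiv.Perm S) (U : ι → S → 𝔸ˣ)

/-- On the unitary group and for Hermitian `A` the exponents are anti-Hermitian: `Y(b)* = −Y(b)`.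
[cite: Balaban1985Variational, (34) p.283] -/
theorem star_Y (hU : ∀ μ x, (((U μ x)⁻¹ : 𝔸ˣ) : 𝔸) = star (U μ x : 𝔸)) (η : ℝ) {A : ι → S → 𝔸}
    (hA : ∀ μ x, star (A μ x) = A μ x) (μ ν : ι) (x : S) (i : Fin 4) :
    star (Y T U η A μ ν x i) = -Y T U η A μ ν x i := by
  have hc : star ((I * η : ℂ)) = -((I * η : ℂ)) := by
    rw [Complex.star_def, map_mul, Complex.conj_I, Complex.conj_ofReal, neg_mul]
  fin_cases i <;>
    simp [Y, star_smul, star_neg, B9Eq310Hermitian.star_R (hU _ _), hA, hc, smul_neg, neg_smul]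

/-- **`V⁽³⁾(A, ∂p)` IS `−η⁻⁴ Re tr(grade4 3 · U₀(∂p))`** for Hermitian `A`, a unitary background and a `*`-trace —
the reading of (35)'s third-order term used by `B11Eq31V4Bound.eq36_of_eq35` ((35) ⇒ (36)).
[cite: Balaban1985Variational, (30) p.282, (35) p.283, (36) p.284] -/
theorem V3p_eq_re [CompleteSpace 𝔸] (hU : ∀ μ x, (((U μ x)⁻¹ : 𝔸ˣ) : 𝔸) = star (U μ x : 𝔸))
    (τ : 𝔸 →ₗ[ℂ] ℂ) (hτs : ∀ a : 𝔸, τ (star a) = starRingEnd ℂ (τ a)) (η : ℝ) {A : ι → S → 𝔸}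
    (hA : ∀ μ x, star (A μ x) = A μ x) (μ ν : ι) (x : S) :
    V3p T U η τ A μ ν x
      = ((η : ℂ)⁻¹) ^ 4 * (-(((τ (grade4 (Y T U η A μ ν x 0) (Y T U η A μ ν x 1) (Y T U η A μ ν x 2)
          (Y T U η A μ ν x 3) 3 * (plaqU T U μ ν x : 𝔸))).re : ℝ) : ℂ)) := by
  unfold V3p
  congr 1
  have hY := star_Y T U hU η hA μ ν x
  rw [← hY 3, ← hY 2, ← hY 1, ← hY 0, ← star_grade4_three, B9Eq310Hermitian.plaqU_unitary T U hU, ← star_mul,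
    hτs, Complex.add_conj]
  push_cast
  ring

/-- **(30)'s `V⁽³⁾(A, ∂p)` IS THE VERBATIM (36)** (`B11Eq34BCH.V3`, in the slots `D = (DA)(p)`, the four Hermitian letters
`A′(b)`, `Re U₀(∂p)`, `η⁻² Im U₀(∂p)` of [5] p. 391): for Hermitian `A`, a unitary background, a tracial `*`-trace and
`η ≠ 0` — by `V3p_eq_re` and «(34) yields (36)» = `B11Eq31V4Bound.eq36_of_eq35`.
[cite: Balaban1985Variational, (30) p.282, (35)-(36) pp.283-284] -/
theorem V3p_eq_eq36 [CompleteSpace 𝔸] (hU : ∀ μ x, (((U μ x)⁻¹ : 𝔸ˣ) : 𝔸) = star (U μ x : 𝔸))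
    (τ : 𝔸 →ₗ[ℂ] ℂ) (hτ : ∀ a b : 𝔸, τ (a * b) = τ (b * a)) (hτs : ∀ a : 𝔸, τ (star a) = starRingEnd ℂ (τ a))
    {η : ℝ} (hη : η ≠ 0) {A : ι → S → 𝔸} (hA : ∀ μ x, star (A μ x) = A μ x) (μ ν : ι) (x : S) :
    V3p T U η τ A μ ν x
      = B11Eq34BCH.V3 τ (curlη T U η A μ ν x) (-(R (U ν x) (A μ (T ν x)))) (-(A ν x)) (A μ x)
          (R (U μ x) (A ν (T μ x))) (reC (plaqU T U μ ν x))
          (((η : ℂ) ^ 2)⁻¹ • imC (plaqU T U μ ν x)) η := by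
  have hW := B9Eq310Hermitian.plaqU_unitary T U hU μ ν x
  -- the Hermitian letters and derivative
  have h₁ : IsSelfAdjoint (-(R (U ν x) (A μ (T ν x)))) := by
    rw [IsSelfAdjoint, star_neg, B9Eq310Hermitian.star_R (hU _ _), hA]
  have h₂ : IsSelfAdjoint (-(A ν x)) := by rw [IsSelfAdjoint, star_neg, hA]
  have h₃ : IsSelfAdjoint (A μ x) := hA μ x
  have h₄ : IsSelfAdjoint (R (U μ x) (A ν (T μ x))) := by
    rw [IsSelfAdjoint, B9Eq310Hermitian.star_R (hU _ _), hA]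
  have hD : IsSelfAdjoint (curlη T U η A μ ν x) := by
    have hA' : star A = A := funext fun κ => funext fun y => hA κ y
    have h := congrFun (congrFun (congrFun (B9Eq310Hermitian.star_curlη T U hU η A) μ) ν) x
    rw [hA'] at h
    exact h
  have hsum : -(R (U ν x) (A μ (T ν x))) + -(A ν x) + A μ x + R (U μ x) (A ν (T μ x))
      = (η : ℂ) • curlη T U η A μ ν x := by
    rw [curlη, smul_inv_smul₀ (Complex.ofReal_ne_zero.2 hη), ← sum_lettersA T U A μ ν x]
    simp only [lettersA, List.sum_cons, List.sum_nil, add_zero]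
    abel
  have h36 := B11Eq31V4Bound.eq36_of_eq35 τ hτs hτ (U0 := (plaqU T U μ ν x : 𝔸)) h₁ h₂ h₃ h₄ hD hη hsum
  -- the slots `Re U₀(∂p)`, `η⁻² Im U₀(∂p)` of [5]
  have hre : (2 : ℂ)⁻¹ • ((plaqU T U μ ν x : 𝔸) + star (plaqU T U μ ν x : 𝔸)) = reC (plaqU T U μ ν x) := by
    rw [reC, hW]
  have him : (((η : ℂ) ^ 2)⁻¹ * (2 * I : ℂ)⁻¹) • ((plaqU T U μ ν x : 𝔸) - star (plaqU T U μ ν x : 𝔸))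
      = ((η : ℂ) ^ 2)⁻¹ • imC (plaqU T U μ ν x) := by
    rw [imC, hW, smul_smul]
  rw [hre, him] at h36
  obtain ⟨e0, e1, e2, e3⟩ := Y_apply T U η A μ ν x
  rw [V3p_eq_re T U hU τ hτs η hA μ ν x, e0, e1, e2, e3, ← h36, ← mul_assoc, ← mul_pow,
    inv_mul_cancel₀ (Complex.ofReal_ne_zero.2 hη), one_pow, one_mul]

end Hermitian


end Literature.MathematicalPhysics.QuantumFieldTheory.Balaban1983to89.B11Eq26ActionExpansion
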